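import Summits.BirchSwinnertonDyer.BirchSwinnertonDyer.Theorems.SignedBaseChangeAnticyclotomicEisensteinDivisibilityAdmdefKolyvaginRoot
import Summits.BirchSwinnertonDyer.BirchSwinnertonDyer.Theorems.SignedBaseChangeAnticyclotomicEisensteinDivisibilityAdmdefTamagawaOfAllRamified
import HarnessLib

/-!
# Line `admdef` (crux `AnticyclotomicEisensteinDivisibility`, stmt-BirchSwinnertonDyer-20727), rigidity road: HOWARD'S THEOREM 3.2.3 (c) AT THE
# ROOT AS AN EQUIVALENCE on the all-ramified cell — `z_{0,1} ≠ 0 ⟺ ([NV] ∧ dim_𝔽p Sel_p(E/K)[p] = 1)` — in kernel modulo ONE named print fact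

LEAD seat bsd-line-sbc-p1 (gen 31), `--supports stmt-BirchSwinnertonDyer-20727` (helper; OFF the v23 composition path).  The sibling
`…AdmdefKolyvaginRoot` proves Kolyvagin's theorem mod `𝔪` at the root (`κ_1(1)_0 ≠ 0 ⟹ Sel^ε_1(K_0, E[p]) = ℤ·κ_1(1)_0`) modulo (CTRL) and (RAM).
Here:
* §1 `finrank_toZModSubmodule_eq_one_of_line` — a `ℤ`-line in a `ZMod p`-module is a `ZMod p`-line (converse of
  `…AdmdefRankOneFinrank.exists_generator_of_finrank_toZModSubmodule_eq_one`).
* §2 the ALL-RAMIFIED cell: (RAM) ⟸ binder (ii) «`E[p]` ramified at every `q ∣ N`» + `(N, d_K) = 1` (`…AdmdefRamifiedBaseChange`), (CTRL) ⟸ the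
  named print fact {Hatley–Lei–Vigni 2022 Lemma 3.7, local form} (`…AdmdefSignedControl.ctrl_of_lemma37_local`):
  `eq_zsmul_limitBaseClass_of_mem_signedOrdSelmerTorsion_one_of_lemma37_local`; in CLASSICAL currency through the rank-one dictionary
  (`…AdmdefTamagawaOfAllRamified` §4) and the injectivity of `T`: ★★ `selmerGroup_line_of_limitBaseClass_ne_zero` — **`z_{0,1} ≠ 0 ⟹
  Sel_p(E/K) = ℤ·X₀`, `X₀ ≠ 0`, `T X₀ = z_{0,1}`** — and `finrank_selmerGroup_eq_one_of_limitBaseClass_ne_zero` — **`⟹ finrank (ZMod p) Sel_p(E/K)[p] = 1`**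
  (the converse of gen 30's `limitBaseClass_layer_zero_one_ne_zero_of_hasUnitLambda_of_finrank_eq_one'`).
* §3 ★★★ `limitBaseClass_layer_zero_one_ne_zero_iff` — **Howard's Thm. 3.2.3 (c) at the root, BOTH WAYS, mod `𝔪`**: for a signed bipartite system `B`
  of sign `ε` at level `N = N_E` with limit base class `z`, on `AcSigned.Setting` + `p ≥ 5`, `ρ̄` onto, Heegner, `(N, d_K) = 1`, binder (ii), given the
  named print fact: `z_{0,1} ≠ 0 ⟺ (B.HasUnitLambda N ∧ finrank (ZMod p) Sel_p(E/K)[p] = 1)`.  `⟹`: §2 + [NV] from the second law at the root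
  (`…AdmdefKolyvaginRoot.hasUnitLambda_of_kappa_one_ne_zero`); `⟸`: gens 28–30 (Howard's merge induction + vanishing lemma).

HONEST FRAMING: theorems only (no definition, no named fact, no `sorry`); the named fact and binder (ii) are HYPOTHESES; nothing about the crux,
the anchors (K1), (RV₁)H without [NV], or BSD is asserted; no summit statement is proved.  For the line's record: the (NP) hypothesis «some pinned
`+` tuple has `z_{0,1} = 0`» of the anchor texts is KERNEL-equivalent, on the all-ramified cell and given [NV], to «`dim_𝔽p Sel_p(E/K)[p] ≠ 1`»
(reading (R5) of `Lines/admdef-lead-g23.md` §5b made a theorem at `d = 1`; its `d ≥ 3` half is the contrapositive of §2).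

References: [cite: Howard2006, Thm. 2.3.7, Thm. 3.2.3] [cite: CastellaEtAl2025, Thm. 7.1 (ii), Thm. 7.4, Thm. 7.5, §7.2 (arXiv:2308.10474v2 pp. 29–31)]
[cite: BurungaleCastellaKim2021, arXiv:1908.09512 Prop. 7.4] [cite: HatleyLeiVigni2022, Lemma 3.7] [cite: GrossLMS1991, Thm. 2.2, §7 (7.1)]
[cite: SerreGaloisCohomology1997, I §2.4].
-/

-- D-0017: single-problem summit, the namespace repeats the problem name by design.
set_option linter.dupNamespace false
set_option autoImplicit false

noncomputable section

open scoped Classical NumberField Pointwise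

namespace Summit.BirchSwinnertonDyer.BirchSwinnertonDyer.Theorems.SignedBaseChangeAcDivAdmdefHowardRootEquivalence

open CategoryTheory WeierstrassCurve NumberField IsDedekindDomain Field Module
open Literature.NumberTheory.EllipticCurves Literature.NumberTheory.GaloisRepresentations
open Literature.NumberTheory.EllipticCurves.CastellaHsuKunduLeeLiu2025
open Literature.NumberTheory.EllipticCurves.BertoliniDarmon2005
open Literature.NumberTheory.EllipticCurves.AcSigned
open Summit.BirchSwinnertonDyer.BirchSwinnertonDyer.Theorems.AdditiveKoly
open Summit.BirchSwinnertonDyer.BirchSwinnertonDyer.Theorems.SignedBaseChangeAcDivAdmdefCoreRootOfSeenAnchor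
open Summit.BirchSwinnertonDyer.BirchSwinnertonDyer.Theorems.SignedBaseChangeAcDivAdmdefSelmerBookkeeping
open Summit.BirchSwinnertonDyer.BirchSwinnertonDyer.Theorems.SignedBaseChangeAcDivAdmdefLayerZeroDictionary
open Summit.BirchSwinnertonDyer.BirchSwinnertonDyer.Theorems.SignedBaseChangeAcDivAdmdefRamifiedBaseChange
open Summit.BirchSwinnertonDyer.BirchSwinnertonDyer.Theorems.SignedBaseChangeAcDivAdmdefSignedControl
open Summit.BirchSwinnertonDyer.BirchSwinnertonDyer.Theorems.SignedBaseChangeAcDivAdmdefTamagawaOfAllRamified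
open Summit.BirchSwinnertonDyer.BirchSwinnertonDyer.Theorems.SignedBaseChangeAcDivAdmdefKolyvaginRoot
open scoped ContRepresentation

universe u

/-! ## §1 A `ℤ`-line is a `ZMod p`-line -/

section LineDictionary

variable {V : Type u} [AddCommGroup V] {p : ℕ} [Fact p.Prime] [Module (ZMod p) V]

/-- **A `ℤ`-line inside a `ZMod p`-module is a `ZMod p`-line**: if `S = ℤ·s` with `s ∈ S`, `s ≠ 0`, then `finrank (ZMod p) S = 1` (the
converse of `…AdmdefRankOneFinrank.exists_generator_of_finrank_toZModSubmodule_eq_one`; `(a : ZMod p) • s = a • s`, `Int.cast_smul_eq_zsmul`). [folklore] -/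
theorem finrank_toZModSubmodule_eq_one_of_line (S : AddSubgroup V) {s : V} (hs : s ∈ S) (hs0 : s ≠ 0)
    (hline : ∀ c ∈ S, ∃ a : ℤ, c = a • s) :
    finrank (ZMod p) (AddSubgroup.toZModSubmodule p S) = 1 := by
  refine finrank_eq_one_iff'.mpr ⟨⟨s, (AddSubgroup.mem_toZModSubmodule p).mpr hs⟩, fun h ↦ hs0 (congrArg Subtype.val h), fun w ↦ ?_⟩
  obtain ⟨a, ha⟩ := hline (w : V) ((AddSubgroup.mem_toZModSubmodule p).mp w.2)
  refine ⟨(a : ZMod p), Subtype.ext ?_⟩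
  rw [Submodule.coe_smul, ha, Int.cast_smul_eq_zsmul]

end LineDictionary

/-! ## §2 The all-ramified cell; CLASSICAL currency -/

section AllRamified

variable {K : Type} [Field K] [NumberField K] {W : WeierstrassCurve ℚ} [W.IsElliptic] [W.IsGloballyMinimal] {p : ℕ} [Fact p.Prime]
  {κ : ZpExtension K p} {γ : absoluteGaloisGroup K} {N : ℕ} {ε : ℤˣ} {B : SignedBipartiteSystem W K p κ} {𝔭 𝔭' : HeightOneSpectrum (𝓞 K)}

/-- **Kolyvagin at the root on the all-ramified cell, modulo HLV Lemma 3.7 (local form)** — for the LIMIT BASE CLASS `z` of `B`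
(`z_{0,1} = κ_1(1)_0`): `AcSigned.Setting` + the named print fact + `(N, d_K) = 1` + binder (ii) «`E[p]` ramified at every `q ∣ N`» + the frame,
and `z_{0,1} ≠ 0` ⟹ every `c ∈ Sel^ε_1(K_0, E[p])` is `a • z_{0,1}`.  ((CTRL) := `ctrl_of_lemma37_local`; (RAM) := `…RamifiedBaseChange.
forall_exists_inertia_smul_ne_baseChange_of_allRamified`.) [cite: Howard2006, Thm. 3.2.3 (c)] [cite: CastellaEtAl2025, Thm. 7.1 (ii), Thm. 7.5]
[cite: HatleyLeiVigni2022, Lemma 3.7] -/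
theorem eq_zsmul_limitBaseClass_of_mem_signedOrdSelmerTorsion_one_of_lemma37_local (hB : IsSignedBipartiteSystem W K p κ γ N ε B)
    {z : Π n j : ℕ, (W.baseChange K).torsionH1Over ((p : ℤ) ^ j) (κ.layerSubgroup n)} (hz : B.IsLimitBaseClass z)
    (hS : Setting W K p κ 𝔭 𝔭') (hloc : hatleyLeiVigni2022_lemma37_local_signedCondition_eq_kummer W K p κ 𝔭 𝔭')
    (hN : (N : ℤ) = W.conductorNorm ℤ) (h5 : 5 ≤ p) (hsurj : W.HasSurjectiveModNGaloisRep p)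
    (hH : SatisfiesHeegnerHypothesis (W.conductorNorm ℤ) K) (hsp : ((Ideal.span {(p : ℤ)}).primesOver (𝓞 K)).ncard = 2)
    (hND : IsCoprime (N : ℤ) (NumberField.discr K))
    (hall : ∀ q : ℕ, q.Prime → q ∣ N → ∃ v' : HeightOneSpectrum (𝓞 ℚ), ((q : ℕ) : 𝓞 ℚ) ∈ v'.asIdeal ∧
      ∃ 𝔓 ∈ v'.primesAbove, ∃ σ ∈ 𝔓.inertia (absoluteGaloisGroup ℚ), ∃ P : W.geomTorsion (p : ℤ), σ • P ≠ P)
    (hz0 : z 0 1 ≠ 0) :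
    ∀ c ∈ signedOrdSelmerTorsion (W.baseChange K) p κ ε 1 0 1, ∃ a : ℤ, c = a • z 0 1 := by
  rw [hz 0 1 one_pos] at hz0 ⊢
  exact eq_zsmul_kappa_one_of_mem_signedOrdSelmerTorsion_one hB hN h5 hsurj hS.isImaginaryQuadratic hH hsp hS.anticyclotomic
    (ctrl_of_lemma37_local W κ hS hH hloc ε)
    (forall_exists_inertia_smul_ne_baseChange_of_allRamified W hS.isImaginaryQuadratic.1 hN hND hall) hz0

/-- **Kolyvagin at the root in CLASSICAL currency** (all-ramified cell, modulo HLV Lemma 3.7 local): `z_{0,1} ≠ 0` ⟹ the classical `p`-Selmer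
group `Sel_p(E/K) ⊆ H¹(K, E[p])` (`selmerGroup (W⁄K) p`, Kummer conditions everywhere) is `ℤ·X₀` for a class `X₀ ∈ Sel_p(E/K)`, `X₀ ≠ 0`, whose
bottom-layer restriction `T X₀` is `z_{0,1}` — via the rank-one dictionary `T X ∈ Sel^ε_1(K_0, E[p]) ⟺ X ∈ Sel_p(E/K)`
(`…AdmdefTamagawaOfAllRamified` §4) and the injectivity of `T`.  This is «`y_K ∉ p E(K)` … ⟹ `Sel_p(E/K)` has rank one» of Kolyvagin–Gross in the
supersingular-anticyclotomic bipartite setting, modulo `𝔪`. [cite: GrossLMS1991, Thm. 2.2 (mod p form)] [cite: Howard2006, Thm. 3.2.3]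
[cite: CastellaEtAl2025, Thm. 7.5, §7.2] [cite: HatleyLeiVigni2022, Lemma 3.7] -/
theorem selmerGroup_line_of_limitBaseClass_ne_zero (hB : IsSignedBipartiteSystem W K p κ γ N ε B)
    {z : Π n j : ℕ, (W.baseChange K).torsionH1Over ((p : ℤ) ^ j) (κ.layerSubgroup n)} (hz : B.IsLimitBaseClass z)
    (hS : Setting W K p κ 𝔭 𝔭') (hloc : hatleyLeiVigni2022_lemma37_local_signedCondition_eq_kummer W K p κ 𝔭 𝔭')
    (hN : (N : ℤ) = W.conductorNorm ℤ) (h5 : 5 ≤ p) (hsurj : W.HasSurjectiveModNGaloisRep p)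
    (hH : SatisfiesHeegnerHypothesis (W.conductorNorm ℤ) K) (hsp : ((Ideal.span {(p : ℤ)}).primesOver (𝓞 K)).ncard = 2)
    (hND : IsCoprime (N : ℤ) (NumberField.discr K))
    (hall : ∀ q : ℕ, q.Prime → q ∣ N → ∃ v' : HeightOneSpectrum (𝓞 ℚ), ((q : ℕ) : 𝓞 ℚ) ∈ v'.asIdeal ∧
      ∃ 𝔓 ∈ v'.primesAbove, ∃ σ ∈ 𝔓.inertia (absoluteGaloisGroup ℚ), ∃ P : W.geomTorsion (p : ℤ), σ • P ≠ P)
    (hz0 : z 0 1 ≠ 0) :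
    ∃ X₀ : Vp W K p,
      resH1Hom (Literature.NumberTheory.EllipticCurves.subgroupIncl (κ.layerSubgroup 0))
          (AddSubgroup.inclusion (geomTorsion_natCast_pow_one W (K := K) (p := p)).le) (fun _ _ ↦ rfl) X₀ = z 0 1 ∧
        X₀ ∈ selmerGroup (W.baseChange K) ((p ^ 1 : ℕ) : ℤ) ∧ X₀ ≠ 0 ∧
        ∀ c ∈ selmerGroup (W.baseChange K) ((p ^ 1 : ℕ) : ℤ), ∃ a : ℤ, c = a • X₀ := by
  have hline := eq_zsmul_limitBaseClass_of_mem_signedOrdSelmerTorsion_one_of_lemma37_local hB hz hS hloc hN h5 hsurj hH hsp hND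
    hall hz0
  have hzSel : z 0 1 ∈ signedOrdSelmerTorsion (W.baseChange K) p κ ε 1 0 1 := by
    rw [hz 0 1 one_pos]; exact kappa_layer_mem_signedOrdSelmerTorsion hB one_pos (one_mem_indefProducts N K _ p 1) 0
  obtain ⟨X₀, hX₀⟩ := exists_resH1Hom_layerZero_eq W κ (z 0 1)
  have hdict := resH1Hom_layerZero_mem_signedOrdSelmerTorsion_one_iff_mem_selmerGroup_of_allRamified W κ hS hH hloc h5 hN hND hall ε
  refine ⟨X₀, hX₀, (hdict X₀).mp (by rw [hX₀]; exact hzSel), fun h ↦ hz0 (by rw [← hX₀, h, map_zero]), fun c hc ↦ ?_⟩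
  obtain ⟨a, ha⟩ := hline _ ((hdict c).mpr hc)
  refine ⟨a, ?_⟩
  -- `T (c − a X₀) = 0` and `T` is injective
  by_contra hne
  have hne' : c - a • X₀ ≠ 0 := sub_ne_zero.mpr hne
  apply res_layerZero_ne_zero W κ hne'
  rw [map_sub, map_zsmul, hX₀, ha, sub_self]

/-- **Hence `finrank (ZMod p) Sel_p(E/K)[p] = 1`** (the line's own currency, for the `ZMod p`-structure of `H¹(K, E[p])` supplied as an instance
binder as in the line's texts): `z_{0,1} ≠ 0 ⟹ dim_𝔽p Sel_p(E/K)[p] = 1` on the all-ramified cell, modulo HLV Lemma 3.7 (local form).  The CONVERSE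
direction of gen 30's `limitBaseClass_layer_zero_one_ne_zero_of_hasUnitLambda_of_finrank_eq_one'`.
[cite: Howard2006, Thm. 2.3.7, Thm. 3.2.3 (c)] [cite: GrossLMS1991, Thm. 2.2] [cite: CastellaEtAl2025, Thm. 7.5] [cite: HatleyLeiVigni2022, Lemma 3.7] -/
theorem finrank_selmerGroup_eq_one_of_limitBaseClass_ne_zero (hB : IsSignedBipartiteSystem W K p κ γ N ε B)
    {z : Π n j : ℕ, (W.baseChange K).torsionH1Over ((p : ℤ) ^ j) (κ.layerSubgroup n)} (hz : B.IsLimitBaseClass z)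
    (hS : Setting W K p κ 𝔭 𝔭') (hloc : hatleyLeiVigni2022_lemma37_local_signedCondition_eq_kummer W K p κ 𝔭 𝔭')
    (hN : (N : ℤ) = W.conductorNorm ℤ) (h5 : 5 ≤ p) (hsurj : W.HasSurjectiveModNGaloisRep p)
    (hH : SatisfiesHeegnerHypothesis (W.conductorNorm ℤ) K) (hsp : ((Ideal.span {(p : ℤ)}).primesOver (𝓞 K)).ncard = 2)
    (hND : IsCoprime (N : ℤ) (NumberField.discr K))
    (hall : ∀ q : ℕ, q.Prime → q ∣ N → ∃ v' : HeightOneSpectrum (𝓞 ℚ), ((q : ℕ) : 𝓞 ℚ) ∈ v'.asIdeal ∧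
      ∃ 𝔓 ∈ v'.primesAbove, ∃ σ ∈ 𝔓.inertia (absoluteGaloisGroup ℚ), ∃ P : W.geomTorsion (p : ℤ), σ • P ≠ P)
    [Module (ZMod p) (Vp W K p)] (hz0 : z 0 1 ≠ 0) :
    finrank (ZMod p) (AddSubgroup.toZModSubmodule p (selmerGroup (W.baseChange K) ((p ^ 1 : ℕ) : ℤ))) = 1 := by
  obtain ⟨X₀, -, hX₀S, hX₀0, hline⟩ := selmerGroup_line_of_limitBaseClass_ne_zero hB hz hS hloc hN h5 hsurj hH hsp hND hall hz0
  exact finrank_toZModSubmodule_eq_one_of_line _ hX₀S hX₀0 hline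

/-! ## §3 Howard's Theorem 3.2.3 (c) at the root, BOTH directions -/

/-- **HOWARD'S RIGIDITY AT THE ROOT modulo `𝔪`, as an EQUIVALENCE, on the all-ramified cell — in kernel modulo ONE named print fact.**  For a
signed bipartite system `B` of sign `ε` at level `N = N_E` (CHKLL25 Thm. 7.4 as typed) with limit base class `z`, on the frame `AcSigned.Setting`
(`p` odd, good supersingular, `a_p = 0`, `K` imaginary quadratic, `p` split, `κ` anticyclotomic, `p ∤ h_K`), `p ≥ 5`, `ρ̄_{E,p}` onto, `N_E` Heegner,
`(N, d_K) = 1`, binder (ii) «`E[p]` ramified at every `q ∣ N`», GIVEN the named print fact {Hatley–Lei–Vigni 2022 Lemma 3.7, local form}: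
**`z_{0,1} ≠ 0 ⟺ (B.HasUnitLambda N ∧ finrank (ZMod p) Sel_p(E/K)[p] = 1)`** — the bottom Heegner-type class is non-zero mod `p` iff Howard's
non-vanishing criterion [NV] holds AND the `p`-Selmer group of `E/K` has `𝔽_p`-dimension one.  `⟹`: §2 (Kolyvagin, sibling file) and [NV] from the second law
at the root; `⟸`: gens 28–30 (Howard's merge induction + vanishing lemma).  Neither (RV₁)H (no [NV] hypothesis) nor any anchor is asserted.
[cite: Howard2006, Thm. 3.2.3 (b)–(c), Thm. 2.3.7] [cite: CastellaEtAl2025, Thm. 7.4, Thm. 7.5 (arXiv:2308.10474v2 pp. 30–31)]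
[cite: BurungaleCastellaKim2021, arXiv:1908.09512 Prop. 7.4] [cite: HatleyLeiVigni2022, Lemma 3.7] [cite: GrossLMS1991, Thm. 2.2] -/
theorem limitBaseClass_layer_zero_one_ne_zero_iff (hB : IsSignedBipartiteSystem W K p κ γ N ε B)
    {z : Π n j : ℕ, (W.baseChange K).torsionH1Over ((p : ℤ) ^ j) (κ.layerSubgroup n)} (hz : B.IsLimitBaseClass z)
    (hS : Setting W K p κ 𝔭 𝔭') (hloc : hatleyLeiVigni2022_lemma37_local_signedCondition_eq_kummer W K p κ 𝔭 𝔭')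
    (hN : (N : ℤ) = W.conductorNorm ℤ) (h5 : 5 ≤ p) (hsurj : W.HasSurjectiveModNGaloisRep p)
    (hH : SatisfiesHeegnerHypothesis (W.conductorNorm ℤ) K) (hsp : ((Ideal.span {(p : ℤ)}).primesOver (𝓞 K)).ncard = 2)
    (hND : IsCoprime (N : ℤ) (NumberField.discr K))
    (hall : ∀ q : ℕ, q.Prime → q ∣ N → ∃ v' : HeightOneSpectrum (𝓞 ℚ), ((q : ℕ) : 𝓞 ℚ) ∈ v'.asIdeal ∧
      ∃ 𝔓 ∈ v'.primesAbove, ∃ σ ∈ 𝔓.inertia (absoluteGaloisGroup ℚ), ∃ P : W.geomTorsion (p : ℤ), σ • P ≠ P)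
    [Module (ZMod p) (Vp W K p)] :
    z 0 1 ≠ 0 ↔
      B.HasUnitLambda N ∧ finrank (ZMod p) (AddSubgroup.toZModSubmodule p (selmerGroup (W.baseChange K) ((p ^ 1 : ℕ) : ℤ))) = 1 := by
  constructor
  · intro hz0
    refine ⟨?_, finrank_selmerGroup_eq_one_of_limitBaseClass_ne_zero hB hz hS hloc hN h5 hsurj hH hsp hND hall hz0⟩
    rw [hz 0 1 one_pos] at hz0
    exact hasUnitLambda_of_kappa_one_ne_zero hB hN h5 hsurj hS.isImaginaryQuadratic hH hsp hS.anticyclotomic hz0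
  · rintro ⟨hNV, hrk⟩
    exact limitBaseClass_layer_zero_one_ne_zero_of_hasUnitLambda_of_finrank_eq_one' hB hz hS hloc hN h5 hsurj hH hsp hND hall hrk hNV

end AllRamified

/-! ## §4 (appended, gen 31) The root equivalence in HYPOTHESIS form — (CTRL)/(RAM), no named fact, no `Setting` -/

section HypothesisForm

variable {K : Type} [Field K] [NumberField K] {W : WeierstrassCurve ℚ} [W.IsElliptic] [W.IsGloballyMinimal] {p : ℕ} [Fact p.Prime]
  {κ : ZpExtension K p} {γ : absoluteGaloisGroup K} {N : ℕ} {ε : ℤˣ} {B : SignedBipartiteSystem W K p κ}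

/-- **Howard's Thm. 3.2.3 (c) at the root, BOTH WAYS, in hypothesis form** (frame `p ≥ 5`, `ρ̄_{E,p}` onto, `K` imaginary quadratic, Heegner,
`p` split, `κ` anticyclotomic; (CTRL) and (RAM) verbatim as in `…AdmdefHowardVanishing`; NO named fact, NO `Setting`): for a signed bipartite system
`B` of sign `ε` at level `N = N_E`, **`κ_1(1)_0 ≠ 0 ⟺ (B.HasUnitLambda N ∧ Sel^ε_1(K_0, E[p]) is a line `ℤ·s`, `s ≠ 0`)**.  `⟹`: the sibling
`…AdmdefKolyvaginRoot` (Kolyvagin at the root + [NV] from the second law), with `s = κ_1(1)_0`; `⟸`: gen 28's `…AdmdefHowardRigidityRoot.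
limitBaseClass_layer_zero_one_ne_zero_of_hasUnitLambda` applied to the tautological limit base class `(n, j) ↦ κ_j(1)_n`.
[cite: Howard2006, Thm. 3.2.3 (b)–(c), Thm. 2.3.7] [cite: CastellaEtAl2025, Thm. 7.4, Thm. 7.5 (arXiv:2308.10474v2 pp. 30–31)]
[cite: BurungaleCastellaKim2021, arXiv:1908.09512 Prop. 7.4] -/
theorem kappa_one_layer_zero_ne_zero_iff (hB : IsSignedBipartiteSystem W K p κ γ N ε B)
    (hN : (N : ℤ) = W.conductorNorm ℤ) (h5 : 5 ≤ p) (hsurj : W.HasSurjectiveModNGaloisRep p) (hK : IsImaginaryQuadratic K)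
    (hH : SatisfiesHeegnerHypothesis (W.conductorNorm ℤ) K) (hsp : ((Ideal.span {(p : ℤ)}).primesOver (𝓞 K)).ncard = 2)
    (hκ : κ.IsAnticyclotomic)
    (hctrl : ∀ v : HeightOneSpectrum (𝓞 K), ((p : ℕ) : 𝓞 K) ∈ v.asIdeal → ∀ X : Vp W K p,
      resH1Hom (Literature.NumberTheory.EllipticCurves.subgroupIncl (κ.layerSubgroup 0))
          (AddSubgroup.inclusion (geomTorsion_natCast_pow_one W (K := K) (p := p)).le) (fun _ _ ↦ rfl) X ∈
        condAboveTorsion (W.baseChange K) p κ v (.sgn ε) 0 1 →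
      X ∈ selmerLocalKer (W.baseChange K) (v.adicCompletion K) ((p ^ 1 : ℕ) : ℤ))
    (hram : ∀ v : HeightOneSpectrum (𝓞 K), ¬ (W.baseChange K).HasGoodReductionAt v → ((p : ℕ) : 𝓞 K) ∉ v.asIdeal →
      ∃ 𝔓 ∈ v.primesAbove, ∃ τ ∈ 𝔓.inertia (absoluteGaloisGroup K), ∃ P : geomTorsion (W.baseChange K) ((p ^ 1 : ℕ) : ℤ), τ • P ≠ P) :
    B.kappa 1 1 0 ≠ 0 ↔
      B.HasUnitLambda N ∧ ∃ s ∈ signedOrdSelmerTorsion (W.baseChange K) p κ ε 1 0 1, s ≠ 0 ∧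
        ∀ c ∈ signedOrdSelmerTorsion (W.baseChange K) p κ ε 1 0 1, ∃ a : ℤ, c = a • s := by
  constructor
  · intro hz0
    obtain ⟨hs, hs0, hline⟩ := signedOrdSelmer_one_line_of_kappa_one_ne_zero hB hN h5 hsurj hK hH hsp hκ hctrl hram hz0
    exact ⟨hasUnitLambda_of_kappa_one_ne_zero hB hN h5 hsurj hK hH hsp hκ hz0, B.kappa 1 1 0, hs, hs0, hline⟩
  · rintro ⟨hNV, s, hs, hs0, hline⟩
    have hz : B.IsLimitBaseClass (fun n j ↦ B.kappa j 1 n) := fun _ _ _ ↦ rfl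
    exact SignedBaseChangeAcDivAdmdefHowardRigidityRoot.limitBaseClass_layer_zero_one_ne_zero_of_hasUnitLambda hB hz hN h5 hsurj hK hH hsp hκ
      hctrl hram hs hs0 hline hNV

end HypothesisForm

end Summit.BirchSwinnertonDyer.BirchSwinnertonDyer.Theorems.SignedBaseChangeAcDivAdmdefHowardRootEquivalence

end
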